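import Summits.NavierStokesRegularity.NavierStokesRegularity.Theorems.TypeICertificateLadderCertificateSoundnessLemmas
import Summits.NavierStokesRegularity.NavierStokesRegularity.Theorems.TypeICertificateLadderNoTypeIBlowupTypeIMorrey

/-!
# Route TypeICertificateLadder — `CertificateSoundness` (item stmt-NavierStokesRegularity-2883)

SOUNDNESS OF TRAJECTORY CERTIFICATES, unconditionally. The route decl
`Theses.TypeICertificateLadder.CertificateSoundness` says: for every `C > 0` there are `ε > 0`,
`ρ > 0` such that for `δ < ε` and every functional `g` bounded on `{V : ‖V‖_∞ ≤ C}` whose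
trajectory inequality `g(U(s₂)) − g(U(s₁)) + ∫_{s₁}^{s₂} ∫_{|y|<ρ} |U|³ ≤ δ (s₂ − s₁)` holds along
the Leray profile `U(s, y) = √(T e^{-s}/ν) · u(T − T e^{-s}, x₀ + √(ν T e^{-s}) y)` of EVERY
classical Leray–Hopf rapidly-decaying-datum solution with eventual rate `√(T − t)‖u‖ ≤ C√ν`, at
every centre `x₀`, the rung `X_C` (such solutions extend smoothly past `T`) holds.

Proof (`typeICertificateLadder_certificateSoundness_proof`). The conclusion `X_C` does not mention
`ε, ρ, δ, g`, so argue by cases on `X_C`. If it holds, any `ε, ρ` do. If it fails, fix an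
offending solution `u` (Type I(`C`) rate, no smooth extension past `T`). It is `IsTypeIBlowup`, so
`morrey_of_typeI` (Seregin–Šverák 2009, Lemma 3.5 at every centre) gives the Morrey-type bound
(e.typeI) with solution-dependent constants, and
`CertificateSoundness.exists_L3_concentration_of_morrey` (Barker–Prange 2020, Thm. 2, at the
singular point of Lemarié-Rieusset's Thm. 15.1 (C)) gives `x₀, ρ, γ` with
`‖u(t)‖_{L³(B(x₀, ρ√(ν(T−t))))} > γν` for `t` near `T`; in similarity variables
(`pow_three_lt_setIntegral_profile`, the dictionary `setIntegral_ball_norm_profile_pow_three`)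
the profile mass `∫_{|y|<ρ}|U(s)|³` exceeds `γ³ =: ε` for all large `s`, while `|U(s)| ≤ C`
(`profile_norm_le`) keeps `|g(U(s))| ≤ M`, and `s ↦ ∫_{|y|<ρ}|U(s)|³` is interval-integrable
(`intervalIntegrable_setIntegral_profile`: jointly continuous integrand, compact closed ball). The
TELESCOPING lemma `not_trajectory_inequality` (average over a window of length `(2M+1)/(ε−δ)`)
then refutes the trajectory inequality of ANY admissible `g` with `δ < ε` along this very
solution at `x₀` — so the hypothesis of the implication is never met. The constants `ε, ρ` depend
on the offending solution, which the quantifier order `∀ C, ∃ ε ρ, ∀ δ g, …` allows; neither the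
crux `TypeIConcentration` (stmt-2881) nor `ScaledEnergyBound` (stmt-2884) is used.

## References

* T. Barker, C. Prange, ARMA 236 (2020), Thm. 2 (arXiv:1812.09115, pp. 4–5).
* I. Tobasco, D. Goluskin, C. R. Doering, Phys. Lett. A 382 (2018) (trajectory inequalities for
  auxiliary functionals bound time averages).
* G. Seregin, V. Šverák, Comm. PDE 34 (2009), Lemma 3.5.
* J. Leray, Acta Math. 63 (1934), §19 (the similarity variables).
-/

noncomputable section

open MeasureTheory Set Function Filter Topology Metric
open Literature.Analysis.FluidPDE
open scoped ENNReal NNReal Pointwise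

namespace Summit.NavierStokesRegularity.NavierStokesRegularity.Theorems

namespace CertificateSoundness

local notation "ℝ³" => EuclideanSpace ℝ (Fin 3)

/-! ### Telescoping -/

/-- **Telescoping mechanism of trajectory certificates** (Tobasco–Goluskin–Doering 2018: a
trajectory inequality bounds the time average of the witness). If `|G s| ≤ M` and `ε ≤ f s` for
`s ≥ a`, `f` is interval-integrable beyond `a`, and `G(s₂) − G(s₁) + ∫_{s₁}^{s₂} f ≤ δ (s₂ − s₁)`
for all `s₀ ≤ s₁ ≤ s₂` with `δ < ε`, contradiction: on the window `[s₁, s₁ + S]`,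
`s₁ = max s₀ a`, `S = (2M + 1)/(ε − δ)`, the left side is `≥ −2M + εS = δS + 1`.
[cite: TobascoGoluskinDoering2018, eq. (4)–(6)] -/
theorem not_trajectory_inequality {G f : ℝ → ℝ} {M ε δ s₀ a : ℝ}
    (hG : ∀ s, a ≤ s → |G s| ≤ M) (hf : ∀ s, a ≤ s → ε ≤ f s)
    (hfi : ∀ b c, a ≤ b → b ≤ c → IntervalIntegrable f volume b c) (hδ : δ < ε)
    (hcert : ∀ s₁ s₂, s₀ ≤ s₁ → s₁ ≤ s₂ →
      G s₂ - G s₁ + ∫ s in s₁..s₂, f s ≤ δ * (s₂ - s₁)) : False := by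
  set s₁ : ℝ := max s₀ a with hs₁
  have ha₁ : a ≤ s₁ := le_max_right _ _
  have hM : 0 ≤ M := (abs_nonneg _).trans (hG s₁ ha₁)
  have hεδ : 0 < ε - δ := sub_pos.2 hδ
  set S : ℝ := (2 * M + 1) / (ε - δ) with hS
  have hSpos : 0 < S := div_pos (by linarith) hεδ
  have h12 : s₁ ≤ s₁ + S := by linarith
  have hc := hcert s₁ (s₁ + S) (le_max_left _ _) h12
  have hint : ε * S ≤ ∫ s in s₁..s₁ + S, f s := by
    have h1 : ∫ _ in s₁..s₁ + S, (ε : ℝ) = ε * S := by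
      rw [intervalIntegral.integral_const, smul_eq_mul]; ring
    rw [← h1]
    exact intervalIntegral.integral_mono_on h12 intervalIntegrable_const (hfi s₁ (s₁ + S) ha₁ h12)
      fun s hs => hf s (ha₁.trans hs.1)
  have hG1 := hG s₁ ha₁
  have hG2 := hG (s₁ + S) (ha₁.trans h12)
  rw [abs_le] at hG1 hG2
  have hkey : ε * S - δ * S = 2 * M + 1 := by
    rw [← sub_mul, hS]
    field_simp
  have hc' : G (s₁ + S) - G s₁ + ∫ s in s₁..s₁ + S, f s ≤ δ * S := by
    simpa only [add_sub_cancel_left] using hc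
  linarith [hG1.1, hG1.2, hG2.1, hG2.2]

/-! ### The similarity dictionary for the local `L³` mass -/

/-- **Affine change of variables**: for `ν, θ > 0`,
`∫_{|y|<ρ} ‖√(θ/ν) v(x₀ + √(νθ) y)‖³ dy = ν⁻³ ∫_{B(x₀, ρ√(νθ))} ‖v(x)‖³ dx`
(amplitude `(θ/ν)^{3/2}` against the Jacobian `(νθ)^{-3/2}`). With `θ = T − t = T e^{-s}` this is
Leray's dictionary `∫_{|y|<ρ} |U(s, y)|³ dy = ν⁻³ ∫_{B(x₀, ρ√(ν(T−t)))} |u(t, x)|³ dx`.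
[cite: Leray1934, §19] -/
theorem setIntegral_ball_norm_profile_pow_three (v : ℝ³ → ℝ³) (x₀ : ℝ³) {ν θ : ℝ} (hν : 0 < ν)
    (hθ : 0 < θ) (ρ : ℝ) :
    ∫ y in ball (0 : ℝ³) ρ, ‖Real.sqrt (θ / ν) • v (x₀ + Real.sqrt (ν * θ) • y)‖ ^ 3 =
      (ν ^ 3)⁻¹ * ∫ x in ball x₀ (ρ * Real.sqrt (ν * θ)), ‖v x‖ ^ 3 := by
  set a : ℝ := Real.sqrt (ν * θ) with ha
  set c : ℝ := Real.sqrt (θ / ν) with hc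
  have hapos : 0 < a := Real.sqrt_pos.2 (mul_pos hν hθ)
  have hcpos : 0 < c := Real.sqrt_pos.2 (div_pos hθ hν)
  have h1 : ∀ y, ‖c • v (x₀ + a • y)‖ ^ 3 = c ^ 3 * ‖v (x₀ + a • y)‖ ^ 3 := fun y => by
    rw [norm_smul, Real.norm_of_nonneg hcpos.le, mul_pow]
  simp_rw [h1]
  rw [integral_const_mul]
  -- scaling `y ↦ a • y`
  have h2 : ∫ y in ball (0 : ℝ³) ρ, ‖v (x₀ + a • y)‖ ^ 3 =
      (a ^ 3)⁻¹ * ∫ z in ball (0 : ℝ³) (a * ρ), ‖v (x₀ + z)‖ ^ 3 := by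
    have h := Measure.setIntegral_comp_smul_of_pos volume
      (fun z : ℝ³ => ‖v (x₀ + z)‖ ^ 3) (ball (0 : ℝ³) ρ) hapos
    rw [finrank_euclideanSpace_fin, _root_.smul_ball hapos.ne', smul_zero, Real.norm_of_nonneg hapos.le,
      smul_eq_mul] at h
    exact h
  -- translation `z ↦ x₀ + z`
  have h3 : ∫ z in ball (0 : ℝ³) (a * ρ), ‖v (x₀ + z)‖ ^ 3 = ∫ x in ball x₀ (a * ρ), ‖v x‖ ^ 3 := by
    have hmp : MeasurePreserving (fun y : ℝ³ => x₀ + y) volume volume :=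
      measurePreserving_add_left volume x₀
    have hemb : MeasurableEmbedding (fun y : ℝ³ => x₀ + y) :=
      (MeasurableEquiv.addLeft x₀).measurableEmbedding
    have hpre : (fun y : ℝ³ => x₀ + y) ⁻¹' ball x₀ (a * ρ) = ball 0 (a * ρ) := by
      ext y
      simp [mem_ball, dist_eq_norm]
    rw [← hpre]
    exact hmp.setIntegral_preimage_emb hemb (fun x => ‖v x‖ ^ 3) (ball x₀ (a * ρ))
  rw [h2, h3, mul_comm a ρ, ← mul_assoc]
  congr 1
  -- constants: `c³ a⁻³ = ν⁻³` because `a = c ν`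
  have hac : a = c * ν := by
    rw [ha, Real.sqrt_eq_iff_eq_sq (by positivity) (by positivity), mul_pow, hc,
      Real.sq_sqrt (by positivity)]
    field_simp
  rw [hac]
  field_simp

/-- **The dimensionless rate in similarity variables**: if `√(T − t) ‖u(t, x)‖ ≤ C √ν` for all `x`
at the time `t = T − T e^{-s}`, then the Leray profile satisfies `‖U(s, y)‖ ≤ C` for all `y`.
[cite: Leray1934, §19] -/
theorem profile_norm_le {ν T C s : ℝ} (hν : 0 < ν) {u : ℝ → ℝ³ → ℝ³} {x₀ : ℝ³}
    (hwin : ∀ x, Real.sqrt (T - (T - T * Real.exp (-s))) * ‖u (T - T * Real.exp (-s)) x‖ ≤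
      C * Real.sqrt ν) (y : ℝ³) :
    ‖Real.sqrt (T * Real.exp (-s) / ν) •
        u (T - T * Real.exp (-s)) (x₀ + Real.sqrt (ν * T * Real.exp (-s)) • y)‖ ≤ C := by
  have hν' : 0 < Real.sqrt ν := Real.sqrt_pos.2 hν
  have h := hwin (x₀ + Real.sqrt (ν * T * Real.exp (-s)) • y)
  rw [sub_sub_cancel] at h
  rw [norm_smul, Real.norm_of_nonneg (Real.sqrt_nonneg _), Real.sqrt_div' _ hν.le,
    div_mul_eq_mul_div, div_le_iff₀ hν']
  exact h

/-- From an `L³` lower bound in `ℝ≥0∞` form to the cube: if `f ∈ L³(μ)`, `0 ≤ b` and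
`ofReal b < ‖f‖_{L³(μ)}`, then `b³ < ∫ ‖f‖³ dμ`. [folklore] -/
theorem pow_three_lt_integral_of_ofReal_lt_eLpNorm {α : Type*} [MeasurableSpace α]
    {μ : Measure α} {F : Type*} [NormedAddCommGroup F] {f : α → F} (hf : MemLp f 3 μ) {b : ℝ}
    (hb : 0 ≤ b) (h : ENNReal.ofReal b < eLpNorm f 3 μ) : b ^ 3 < ∫ x, ‖f x‖ ^ 3 ∂μ := by
  rw [hf.eLpNorm_eq_integral_rpow_norm (by norm_num) (by norm_num)] at h
  simp only [ENNReal.toReal_ofNat] at h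
  rw [ENNReal.ofReal_lt_ofReal_iff'] at h
  have hI : 0 ≤ ∫ x, ‖f x‖ ^ (3 : ℝ) ∂μ := integral_nonneg fun _ => by positivity
  have h3 : ∫ x, ‖f x‖ ^ (3 : ℝ) ∂μ = ∫ x, ‖f x‖ ^ 3 ∂μ := by
    refine integral_congr_ae (Eventually.of_forall fun x => ?_)
    exact_mod_cast Real.rpow_natCast ‖f x‖ 3
  have h4 := pow_lt_pow_left₀ h.1 hb three_ne_zero
  have h5 : ((∫ x, ‖f x‖ ^ (3 : ℝ) ∂μ) ^ (3 : ℝ)⁻¹) ^ 3 = ∫ x, ‖f x‖ ^ (3 : ℝ) ∂μ := by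
    simpa only [Nat.cast_ofNat] using Real.rpow_inv_natCast_pow hI (n := 3) three_ne_zero
  rwa [h5, h3] at h4

/-- **`L³` concentration in similarity variables**: for `ν, θ > 0`, a continuous bounded slice
`v` with `‖v‖_{L³(B(x₀, ρ√(νθ)))} > γν` (`γ ≥ 0`) has profile mass
`∫_{|y|<ρ} ‖√(θ/ν) v(x₀ + √(νθ) y)‖³ dy > γ³`. [cite: Leray1934, §19] -/
theorem pow_three_lt_setIntegral_profile {ν θ γ ρ K : ℝ} (hν : 0 < ν) (hθ : 0 < θ) (hγ : 0 ≤ γ)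
    {v : ℝ³ → ℝ³} (hv : Continuous v) (hK : ∀ x, ‖v x‖ ≤ K) {x₀ : ℝ³}
    (hconc : ENNReal.ofReal (γ * ν) <
      eLpNorm v 3 (volume.restrict (ball x₀ (ρ * Real.sqrt (ν * θ))))) :
    γ ^ 3 < ∫ y in ball (0 : ℝ³) ρ, ‖Real.sqrt (θ / ν) • v (x₀ + Real.sqrt (ν * θ) • y)‖ ^ 3 := by
  rw [setIntegral_ball_norm_profile_pow_three v x₀ hν hθ ρ]
  haveI : IsFiniteMeasure (volume.restrict (ball x₀ (ρ * Real.sqrt (ν * θ)))) :=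
    isFiniteMeasure_restrict.2 measure_ball_lt_top.ne
  have hmem : MemLp v 3 (volume.restrict (ball x₀ (ρ * Real.sqrt (ν * θ)))) :=
    MemLp.of_bound hv.aestronglyMeasurable K (Eventually.of_forall hK)
  have h := pow_three_lt_integral_of_ofReal_lt_eLpNorm hmem (by positivity) hconc
  rw [show γ ^ 3 = (ν ^ 3)⁻¹ * (γ * ν) ^ 3 by field_simp]
  exact mul_lt_mul_of_pos_left h (by positivity)

/-! ### Continuity of the profile mass in similarity time -/

/-- `B(x, r)` and `B̄(x, r)` agree up to a Lebesgue-null set in `ℝ³` (the sphere is null).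
[folklore] -/
theorem ball_ae_eq_closedBall_volume (x : ℝ³) (r : ℝ) :
    ball x r =ᵐ[volume] closedBall x r := by
  refine ae_eq_of_subset_of_measure_ge ball_subset_closedBall ?_
    measurableSet_ball.nullMeasurableSet measure_closedBall_lt_top.ne
  rw [Measure.addHaar_closedBall_eq_addHaar_ball volume x r]

/-- **Joint continuity of the (time-clamped) Leray profile**: for `u` classical on `[0, T)`,
`T > 0`, the map `(s, y) ↦ U(max s 0, y)` is continuous on `ℝ × ℝ³`, because
`t = T − T e^{-s'} ∈ [0, T)` for `s' = max s 0 ≥ 0` and `u` is jointly continuous on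
`[0, T) × ℝ³`. [folklore] -/
theorem continuous_profile_clamped {ν T : ℝ} (hT : 0 < T) {u : ℝ → ℝ³ → ℝ³} {p : ℝ → ℝ³ → ℝ}
    (hsol : IsClassicalNSSolutionOn (Ico 0 T) ν 0 u p) (x₀ : ℝ³) :
    Continuous fun q : ℝ × ℝ³ =>
      Real.sqrt (T * Real.exp (-max q.1 0) / ν) •
        u (T - T * Real.exp (-max q.1 0)) (x₀ + Real.sqrt (ν * T * Real.exp (-max q.1 0)) • q.2) := by
  have hcont : ContinuousOn (uncurry u) (Ico 0 T ×ˢ univ) := hsol.smooth_velocity.continuousOn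
  have hφ : Continuous fun q : ℝ × ℝ³ =>
      (T - T * Real.exp (-max q.1 0), x₀ + Real.sqrt (ν * T * Real.exp (-max q.1 0)) • q.2) := by
    fun_prop
  have hmaps : ∀ q : ℝ × ℝ³,
      (T - T * Real.exp (-max q.1 0), x₀ + Real.sqrt (ν * T * Real.exp (-max q.1 0)) • q.2) ∈
        Ico 0 T ×ˢ (univ : Set ℝ³) := by
    intro q
    refine ⟨⟨?_, ?_⟩, mem_univ _⟩
    · have h1 : Real.exp (-max q.1 0) ≤ 1 := Real.exp_le_one_iff.2 (by simp)
      nlinarith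
    · have h1 : 0 < T * Real.exp (-max q.1 0) := by positivity
      linarith
  have h1 : Continuous fun q : ℝ × ℝ³ =>
      uncurry u (T - T * Real.exp (-max q.1 0),
        x₀ + Real.sqrt (ν * T * Real.exp (-max q.1 0)) • q.2) :=
    hcont.comp_continuous hφ hmaps
  have h2 : Continuous fun q : ℝ × ℝ³ => Real.sqrt (T * Real.exp (-max q.1 0) / ν) := by
    fun_prop
  exact h2.smul h1

/-- **Interval integrability of the profile mass**: for `u` classical on `[0, T)`, `T > 0`, and
`U` its Leray profile at `(T, x₀)`, the function `s ↦ ∫_{|y|<ρ} ‖U(s, y)‖³ dy` is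
interval-integrable on every `[b, c]` with `0 ≤ b ≤ c` — it is continuous on `[0, ∞)` (parametric
integral of a jointly continuous integrand over the compact closed ball, which carries the same
integral as the open ball). [folklore] -/
theorem intervalIntegrable_setIntegral_profile {ν T : ℝ} (hT : 0 < T) {u : ℝ → ℝ³ → ℝ³}
    {p : ℝ → ℝ³ → ℝ} (hsol : IsClassicalNSSolutionOn (Ico 0 T) ν 0 u p) (x₀ : ℝ³) (ρ : ℝ)
    {U : ℝ → ℝ³ → ℝ³}
    (hU : ∀ s y, U s y = Real.sqrt (T * Real.exp (-s) / ν) •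
      u (T - T * Real.exp (-s)) (x₀ + Real.sqrt (ν * T * Real.exp (-s)) • y))
    {b c : ℝ} (hb : 0 ≤ b) (hbc : b ≤ c) :
    IntervalIntegrable (fun s => ∫ y in ball (0 : ℝ³) ρ, ‖U s y‖ ^ 3) volume b c := by
  have hF : Continuous (uncurry fun (s : ℝ) (y : ℝ³) =>
      ‖Real.sqrt (T * Real.exp (-max s 0) / ν) •
        u (T - T * Real.exp (-max s 0)) (x₀ + Real.sqrt (ν * T * Real.exp (-max s 0)) • y)‖ ^ 3) := by
    rw [Function.uncurry_def]
    exact ((continuous_profile_clamped hT hsol x₀).norm).pow 3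
  have hfcl : Continuous fun s : ℝ => ∫ y in closedBall (0 : ℝ³) ρ,
      ‖Real.sqrt (T * Real.exp (-max s 0) / ν) •
        u (T - T * Real.exp (-max s 0)) (x₀ + Real.sqrt (ν * T * Real.exp (-max s 0)) • y)‖ ^ 3 :=
    continuous_parametric_integral_of_continuous
      (f := fun (s : ℝ) (y : ℝ³) => ‖Real.sqrt (T * Real.exp (-max s 0) / ν) •
        u (T - T * Real.exp (-max s 0)) (x₀ + Real.sqrt (ν * T * Real.exp (-max s 0)) • y)‖ ^ 3)
      hF (isCompact_closedBall (0 : ℝ³) ρ)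
  refine ContinuousOn.intervalIntegrable ?_
  rw [uIcc_of_le hbc]
  refine hfcl.continuousOn.congr fun s hs => ?_
  have hs0 : 0 ≤ s := hb.trans hs.1
  simp only
  rw [setIntegral_congr_set (ball_ae_eq_closedBall_volume (0 : ℝ³) ρ)]
  refine setIntegral_congr_fun measurableSet_closedBall fun y _ => ?_
  rw [hU, max_eq_left hs0]

/-! ### Similarity time -/

/-- `T − T e^{-s} > t₁` for all large `s` whenever `t₁ < T`: `T e^{-s} → 0`. [folklore] -/
theorem exists_forall_lt_time {T t₁ : ℝ} (ht₁ : t₁ < T) :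
    ∃ s₁ : ℝ, ∀ s, s₁ ≤ s → t₁ < T - T * Real.exp (-s) := by
  have h : Tendsto (fun s : ℝ => T * Real.exp (-s)) atTop (𝓝 (T * 0)) :=
    Real.tendsto_exp_neg_atTop_nhds_zero.const_mul T
  rw [mul_zero] at h
  have hev : ∀ᶠ s in atTop, T * Real.exp (-s) < T - t₁ :=
    (tendsto_order.1 h).2 _ (sub_pos.2 ht₁)
  obtain ⟨s₁, hs₁⟩ := eventually_atTop.1 hev
  exact ⟨s₁, fun s hs => by linarith [hs₁ s hs]⟩

/-- For `s ≥ 0` the similarity time `t = T − T e^{-s}` lies in `[0, T)` (`T > 0`). [folklore] -/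
theorem time_mem_Ico {T s : ℝ} (hT : 0 < T) (hs : 0 ≤ s) : T - T * Real.exp (-s) ∈ Ico 0 T := by
  refine ⟨?_, ?_⟩
  · have h1 : Real.exp (-s) ≤ 1 := Real.exp_le_one_iff.2 (by linarith)
    nlinarith
  · have h1 : 0 < T * Real.exp (-s) := by positivity
    linarith

end CertificateSoundness

/-! ### The route item -/

/-- **Soundness of trajectory certificates** (item stmt-NavierStokesRegularity-2883, route decl
`Theses.TypeICertificateLadder.CertificateSoundness`, UNCONDITIONAL): for every `C > 0` there are
`ε, ρ > 0` such that a functional `g`, bounded on `{‖V‖_∞ ≤ C}` and satisfying the trajectory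
inequality with slack `δ < ε` along the Leray profile of every Type-I(`C`) classical Leray–Hopf
solution at every centre, certifies the rung `X_C`. By cases on `X_C`; in the failing case the
offending solution concentrates in `L³` at the similarity scale around its singular point
(`morrey_of_typeI`, `CertificateSoundness.exists_L3_concentration_of_morrey` — Barker–Prange 2020
Thm. 2), `ε := γ³`, and the telescoping lemma `CertificateSoundness.not_trajectory_inequality`
shows that no admissible certificate exists. [cite: BarkerPrange2020, Thm. 2;
TobascoGoluskinDoering2018] -/
theorem typeICertificateLadder_certificateSoundness_proof :
    Summit.NavierStokesRegularity.NavierStokesRegularity.Theses.TypeICertificateLadder.CertificateSoundness := by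
  unfold Summit.NavierStokesRegularity.NavierStokesRegularity.Theses.TypeICertificateLadder.CertificateSoundness
  intro C hC
  by_cases hX : ∀ (ν T : ℝ), 0 < ν → 0 < T →
      ∀ (u : ℝ → EuclideanSpace ℝ (Fin 3) → EuclideanSpace ℝ (Fin 3))
        (p : ℝ → EuclideanSpace ℝ (Fin 3) → ℝ),
      IsClassicalNSSolutionOn (Ico 0 T) ν 0 u p → IsLerayHopfOn T ν 0 (u 0) u →
      HasRapidSpatialDecay (u 0) →
      (∀ᶠ t in 𝓝[<] T, ∀ x, Real.sqrt (T - t) * ‖u t x‖ ≤ C * Real.sqrt ν) →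
      HasSmoothExtensionPast ν 0 u T
  · exact ⟨1, one_pos, 1, one_pos, fun _ _ _ _ _ => hX⟩
  push Not at hX
  obtain ⟨ν, T, hν, hT, u, p, hsol, hLH, hdec, hrate, hext⟩ := hX
  -- the offending solution is Type I, hence Morrey-bounded, hence concentrates in `L³`
  have hI : IsTypeIBlowup u T := by
    refine ⟨C * Real.sqrt ν, ?_⟩
    filter_upwards [hrate, self_mem_nhdsWithin] with t ht htT
    intro x
    have hpos : 0 < Real.sqrt (T - t) := Real.sqrt_pos.2 (sub_pos.2 htT)
    rw [le_div_iff₀ hpos, mul_comm]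
    exact ht x
  obtain ⟨r₀, M₀, T₁, hr₀, hT₁, hMor⟩ := morrey_of_typeI hν hT hsol hLH hI
  obtain ⟨x₀, ρ, γ, t₁, hρ, hγ, ht₁, hconc⟩ :=
    CertificateSoundness.exists_L3_concentration_of_morrey hν hT hsol hLH hdec hext hr₀ hT₁ hMor
  -- the rate window
  obtain ⟨T₂, hT₂T, hwin⟩ := mem_nhdsLT_iff_exists_Ioo_subset.1 hrate
  refine ⟨γ ^ 3, by positivity, ρ, hρ, fun δ hδ g hg hTraj => ?_⟩
  exfalso
  obtain ⟨M, hM⟩ := hg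
  set U : ℝ → EuclideanSpace ℝ (Fin 3) → EuclideanSpace ℝ (Fin 3) := fun s y =>
    Real.sqrt (T * Real.exp (-s) / ν) •
      u (T - T * Real.exp (-s)) (x₀ + Real.sqrt (ν * T * Real.exp (-s)) • y) with hU
  obtain ⟨s₀, hs₀⟩ : ∃ s₀ : ℝ, ∀ s₁ s₂ : ℝ, s₀ ≤ s₁ → s₁ ≤ s₂ →
      g (U s₂) - g (U s₁) +
        (∫ s in s₁..s₂, ∫ y in ball (0 : EuclideanSpace ℝ (Fin 3)) ρ, ‖U s y‖ ^ 3) ≤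
          δ * (s₂ - s₁) :=
    hTraj ν T hν hT u p hsol hLH hdec hrate x₀
  have hU' : ∀ s y, U s y = Real.sqrt (T * Real.exp (-s) / ν) •
      u (T - T * Real.exp (-s)) (x₀ + Real.sqrt (ν * T * Real.exp (-s)) • y) := fun s y => by
    rw [hU]
  -- similarity-time threshold: beyond `a`, `t = T − T e^{-s}` lies in both windows and in `[0, T)`
  obtain ⟨s₁, hs₁⟩ := CertificateSoundness.exists_forall_lt_time (T := T) (max_lt ht₁ hT₂T)
  set a : ℝ := max s₁ 0 with ha
  have hwin' : ∀ s, a ≤ s → ∀ x, Real.sqrt (T - (T - T * Real.exp (-s))) *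
      ‖u (T - T * Real.exp (-s)) x‖ ≤ C * Real.sqrt ν := fun s hs x =>
    hwin ⟨(le_max_right _ _).trans_lt (hs₁ s ((le_max_left _ _).trans hs)),
      (CertificateSoundness.time_mem_Ico hT ((le_max_right _ _).trans hs)).2⟩ x
  refine CertificateSoundness.not_trajectory_inequality (G := fun s => g (U s))
    (f := fun s => ∫ y in ball (0 : EuclideanSpace ℝ (Fin 3)) ρ, ‖U s y‖ ^ 3) (a := a)
    (fun s hs => hM (U s) fun y => ?_) (fun s hs => ?_)
    (fun b c hb hbc => CertificateSoundness.intervalIntegrable_setIntegral_profile hT hsol x₀ ρ hU'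
      ((le_max_right _ _).trans hb) hbc) hδ hs₀
  · -- `‖U s y‖ ≤ C`
    rw [hU']
    exact CertificateSoundness.profile_norm_le hν (hwin' s hs) y
  · -- `γ³ ≤ ∫_{|y|<ρ} ‖U s y‖³`
    have hs0 : 0 ≤ s := (le_max_right _ _).trans hs
    have htI := CertificateSoundness.time_mem_Ico hT hs0
    have ht₁t : t₁ < T - T * Real.exp (-s) :=
      (le_max_left _ _).trans_lt (hs₁ s ((le_max_left _ _).trans hs))
    have hθ : 0 < T * Real.exp (-s) := by positivity
    have hc := hconc (T - T * Real.exp (-s)) ⟨ht₁t, htI.2⟩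
    rw [sub_sub_cancel, ← mul_assoc] at hc
    -- the slice is continuous and bounded (rate window)
    have hcont : Continuous (u (T - T * Real.exp (-s))) := (hsol.contDiff_velocity htI).continuous
    have hbd : ∀ x, ‖u (T - T * Real.exp (-s)) x‖ ≤
        C * Real.sqrt ν / Real.sqrt (T * Real.exp (-s)) := fun x => by
      have h1 := hwin' s hs x
      rw [sub_sub_cancel] at h1
      rw [le_div_iff₀ (Real.sqrt_pos.2 hθ), mul_comm]
      exact h1
    have key := CertificateSoundness.pow_three_lt_setIntegral_profile hν hθ hγ.le hcont hbd
      (x₀ := x₀) (ρ := ρ) (by rwa [← mul_assoc])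
    refine le_of_lt (lt_of_lt_of_eq key ?_)
    refine setIntegral_congr_fun measurableSet_ball fun y _ => ?_
    rw [hU', mul_assoc]

end Summit.NavierStokesRegularity.NavierStokesRegularity.Theorems

end
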